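import Summits.ResolutionOfSingularities.ResolutionOfSingularities.Theorems.RadicialJungCleanModelsCcurveCoarseCentre
import Summits.ResolutionOfSingularities.ResolutionOfSingularities.Theorems.RadicialJungCleanModelsCcurveRebaseHzd
import Summits.ResolutionOfSingularities.ResolutionOfSingularities.Theorems.RadicialJungCleanModelsCleanLU3CompositeCdiv
import HarnessLib

/-!
# Route `RadicialJung`, crux `CleanModels` (stmt-15917) — (C-curve) sub-line: STUB `stub_Cc_rebaseD2` PROVED (S0 + S1 of the plan)

Lead `res-B-lead-1` g6 (plan `Cruxes/CleanModels/Lines/Sketch-memo-Ccurve-plan.md` §1 S0/S1; workfile `Cruxes/CleanModels/Lines/Sketch_Ccurve_assembly.lean` v2.3, stub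
`Ccurve.stub_Cc_rebaseD2` VERBATIM).  OURS · counted 0.  Nothing here proves resolution in characteristic `p`; resolution in char `p` is NOT proved; `CossartPiltant2019`
(F-02) is a PRINTED theorem typed as a hypothesis.

`rebaseD2`: under the hypotheses of the research stub :249‴ with a PERFECT ground field (unused here), NO divisorial coarsening and a PROPER coarsening `O < O₁ < K`: a model
`B ⊇ A` inside `O`, regular of dimension 3 at the centre of `O`, whose local ring at the centre of `O₁` is regular of dimension 2 with fraction field `K` (✓
`exists_model_coarseCentre_curve`, mod F-02), and a 2-dimensional regular local ring `R₁` between `locAtCentre B O₁` and `O₁` carrying a loosely clean representative of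
the `K^p`-line of `g₀` — obtained by REBASING over `F = k⟮t⟯` (`t ∈ B ∩ 𝔪_O` an `O₁`-unit): `Ā = F[generators of B]` is an `F`-model inside `O₁` with the same local ring
at the centre of `O₁` (✓ `mem_locAtCentre_of_mem_adjoin_simple`), all `F`-models above it have MAXIMAL centre for `O₁` (✓ `isMaximal_subringCentre_of_rebase`), so
clean local uniformization in dimension two ✓ `stub_cleanLU2` (p715104, unconditional) applies AT `v₁` over the ground field `F`.
-/

noncomputable section

set_option linter.dupNamespace false

open IsLocalRing
open Literature.AlgebraicGeometry.Resolution

namespace Summit.ResolutionOfSingularities.ResolutionOfSingularities.Theorems.RadicialJung.CleanModels.Ccurve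

/-- **`stub_Cc_rebaseD2` of the (C-curve) workfile, PROVED** (statement verbatim): see the module docstring. [folklore] -/
theorem rebaseD2 (hCP : CossartPiltant2019.{0}) :
    ∀ (p : ℕ), p.Prime →
    ∀ (k : Type) [Field k] [CharP k p] [PerfectField k] (K : Type) [Field K] [Algebra k K]
    (O : ValuationSubring K) (A : Subalgebra k K), A.toSubring ≤ O.toSubring → A.FG → IsFractionRing A K →
    ringKrullDim A ≤ 3 → IsRegularLocalRing (locAtCentre A.toSubring O) →
    ringKrullDim (locAtCentre A.toSubring O) = 3 →
    (∀ (T : Subring K) (hT : T ≤ O.toSubring), A.toSubring ≤ T → (subringCentre T O hT).IsMaximal) →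
    ∀ g₀ : K, (∀ c : K, c ^ p ≠ g₀) →
    ¬ (∃ (O₁ : ValuationSubring K), O ≤ O₁ ∧ O₁ ≠ ⊤ ∧ ∃ y : Fin 2 → K, (∀ i, y i ∈ O) ∧
      ∀ P : MvPolynomial (Fin 2) k, P ≠ 0 → O₁.valuation (MvPolynomial.aeval y P) = 1) →
    ∀ (O₁ : ValuationSubring K), O ≤ O₁ → O₁ ≠ O → O₁ ≠ ⊤ →
    ∃ (B : Subalgebra k K), B.toSubring ≤ O.toSubring ∧ A ≤ B ∧ B.FG ∧
    IsRegularLocalRing (locAtCentre B.toSubring O) ∧ ringKrullDim (locAtCentre B.toSubring O) = 3 ∧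
    IsRegularLocalRing (locAtCentre B.toSubring O₁) ∧ ringKrullDim (locAtCentre B.toSubring O₁) = 2 ∧
    IsLocalRingOf (locAtCentre B.toSubring O₁) ∧
    ∃ (R₁ : Subring K), R₁ ≤ O₁.toSubring ∧ SubringDominates (locAtCentre B.toSubring O₁) R₁ ∧ SubringDominates R₁ O₁.toSubring ∧
    ringKrullDim ↥R₁ = 2 ∧
    ∃ (_ : IsRegularLocalRing ↥R₁) (c : Fin p → K), (∃ j : Fin p, (j : ℕ) ≠ 0 ∧ c j ≠ 0) ∧
    ((∃ (d m : ℕ) (hmd : m ≤ d) (t : Fin d → ↥R₁) (a : Fin m → ℕ) (u : ↥R₁), IsUnit u ∧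
    Ideal.span (Set.range t) = IsLocalRing.maximalIdeal ↥R₁ ∧
    ringKrullDim ↥R₁ = (d : WithBot ℕ∞) ∧ 0 < m ∧ (∀ i, ¬ p ∣ a i) ∧
    (∑ j : Fin p, c j ^ p * g₀ ^ (j : ℕ)) = (u : K) * ∏ i : Fin m, ((t (Fin.castLE hmd i) : ↥R₁) : K) ^ (a i)) ∨
    (∃ u : ↥R₁, IsUnit u ∧ (∑ j : Fin p, c j ^ p * g₀ ^ (j : ℕ)) = (u : K) ∧
    ∀ c' : ↥R₁, u - c' ^ p ∉ IsLocalRing.maximalIdeal ↥R₁) ∨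
    (∃ s c' : ↥R₁, (∑ j : Fin p, c j ^ p * g₀ ^ (j : ℕ)) = (s : K) ∧
    s - c' ^ p ∈ IsLocalRing.maximalIdeal ↥R₁ ∧
    s - c' ^ p ∉ IsLocalRing.maximalIdeal ↥R₁ ^ 2))  := by
  intro p hp k _ _ _ K _ _ O A hAO hAfg hfrac hdimA hreg hdim3 hzd g₀ hg₀ hdiv O₁ hOO₁ hne hO₁
  classical
  haveI := hfrac
  haveI : Fact p.Prime := ⟨hp⟩
  obtain ⟨B, hBO, hAB, hBfg, hBreg, hBdim, hBreg₁, hBdim₁, hBof, t, htB, hvt, hv₁t⟩ :=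
    exists_model_coarseCentre_curve hCP O A hAO hAfg hfrac hdim3 hzd hdiv O₁ hOO₁ hne hO₁
  have hBO₁ : B.toSubring ≤ O₁.toSubring := fun z hz => hOO₁ (hBO hz)
  haveI hfrB : IsFractionRing B K := isFractionRing_of_le hAB hfrac
  -- the rebasing field `F = k⟮t⟯ ⊆ locAtCentre B O₁`
  let F : IntermediateField k K := IntermediateField.adjoin k ({t} : Set K)
  haveI : CharP F p := charP_of_injective_algebraMap (algebraMap k F).injective p
  have hFR₀ : ∀ z : F, (z : K) ∈ locAtCentre B.toSubring O₁ := fun z =>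
    mem_locAtCentre_of_mem_adjoin_simple O O₁ hOO₁ B hBO t htB hvt hv₁t z.2
  -- the `F`-model `Ā = F[s]`, `B = k[s]`
  obtain ⟨s, hs⟩ := hBfg
  let Ā : Subalgebra F K := Algebra.adjoin F (s : Set K)
  have hsĀ : ∀ x ∈ (s : Set K), x ∈ Ā := fun x hx => Algebra.subset_adjoin hx
  have hsB : ∀ x ∈ (s : Set K), x ∈ B := fun x hx => by
    rw [← hs]; exact Algebra.subset_adjoin hx
  have hBĀ : B.toSubring ≤ Ā.toSubring := by
    intro z hz
    have hz' : z ∈ Algebra.adjoin k (s : Set K) := by rw [hs]; exact hz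
    have h1 : Algebra.adjoin k (s : Set K) ≤ Ā.restrictScalars k :=
      Algebra.adjoin_le fun x hx => (Subalgebra.mem_restrictScalars k).mpr (hsĀ x hx)
    exact (Subalgebra.mem_restrictScalars k).mp (h1 hz')
  let R₀' : Subalgebra F K := { locAtCentre B.toSubring O₁ with algebraMap_mem' := fun z => hFR₀ z }
  have hĀR₀ : Ā.toSubring ≤ locAtCentre B.toSubring O₁ := by
    have h1 : Ā ≤ R₀' := Algebra.adjoin_le fun x hx => le_locAtCentre _ _ (hsB x hx)
    exact fun z hz => h1 hz
  have hĀO₁ : Ā.toSubring ≤ O₁.toSubring := fun z hz => locAtCentre_le hBO₁ (hĀR₀ hz)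
  have hloc : locAtCentre Ā.toSubring O₁ = locAtCentre B.toSubring O₁ := by
    apply le_antisymm
    · calc locAtCentre Ā.toSubring O₁ ≤ locAtCentre (locAtCentre B.toSubring O₁) O₁ := locAtCentre_mono O₁ hĀR₀
        _ = locAtCentre B.toSubring O₁ := locAtCentre_locAtCentre _ _
    · exact locAtCentre_mono O₁ hBĀ
  have hĀfg : Ā.FG := ⟨s, rfl⟩
  haveI hfrĀ : IsFractionRing Ā K := by
    refine IsFractionRing.of_field _ K fun z => ?_
    obtain ⟨a, b, hb, hab⟩ := IsFractionRing.div_surjective (A := B) z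
    exact ⟨⟨a, hBĀ a.2⟩, ⟨b, hBĀ b.2⟩, hab.symm⟩
  have hregĀ : IsRegularLocalRing (locAtCentre Ā.toSubring O₁) := by rw [hloc]; exact hBreg₁
  have hdimĀ : ringKrullDim (locAtCentre Ā.toSubring O₁) = 2 := by rw [hloc]; exact hBdim₁
  have hzdF : ∀ (T : Subring K) (hT : T ≤ O₁.toSubring), Ā.toSubring ≤ T → (subringCentre T O₁ hT).IsMaximal := by
    intro T hT hĀT
    exact isMaximal_subringCentre_of_rebase O O₁ hOO₁ hO₁ hdiv B hBO t htB hvt hv₁t T (hBĀ.trans hĀT) hT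
      (fun z hz => hĀT (Ā.algebraMap_mem (⟨z, hz⟩ : F)))
  -- D2 over `F` at `O₁`
  obtain ⟨Ā', hĀ'O₁, hĀĀ', hĀ'fg, hreg', c, hc, hforms⟩ := stub_cleanLU2 p hp F K O₁ Ā hĀO₁ hĀfg hfrĀ hregĀ hdimĀ hzdF g₀ hg₀
  have hR₁O₁ : locAtCentre Ā'.toSubring O₁ ≤ O₁.toSubring := locAtCentre_le hĀ'O₁
  have hĀĀ's : Ā.toSubring ≤ Ā'.toSubring := fun z hz => hĀĀ' hz
  -- dimension of `R₁ = locAtCentre Ā' O₁`: `dim Ā' = trdeg_F K = dim Ā = 2`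
  haveI : Algebra.FiniteType F Ā := Ā.fg_iff_finiteType.mp hĀfg
  haveI : Algebra.FiniteType F Ā' := Ā'.fg_iff_finiteType.mp hĀ'fg
  haveI hfrĀ' : IsFractionRing Ā' K := isFractionRing_of_le hĀĀ' hfrĀ
  have hdimR₁ : ringKrullDim (locAtCentre Ā'.toSubring O₁) = 2 := by
    rw [ringKrullDim_locAtCentre_eq_of_isMaximal Ā' hĀ'fg O₁ hĀ'O₁ (hzdF _ hĀ'O₁ hĀĀ's)]
    have h1 : ringKrullDim Ā = 2 := by
      rw [← ringKrullDim_locAtCentre_eq_of_isMaximal Ā hĀfg O₁ hĀO₁ (hzdF _ hĀO₁ le_rfl)]; exact hdimĀ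
    obtain ⟨n₁, hn₁, htr₁⟩ := exists_ringKrullDim_eq_and_trdeg_eq F Ā
    obtain ⟨n₂, hn₂, htr₂⟩ := exists_ringKrullDim_eq_and_trdeg_eq F Ā'
    have h12 : n₁ = n₂ := by
      have e1 := trdeg_eq_trdeg_of_isFractionRing Ā
      have e2 := trdeg_eq_trdeg_of_isFractionRing Ā'
      rw [htr₁] at e1; rw [htr₂] at e2
      exact_mod_cast e1.symm.trans e2
    rw [hn₂, ← h12, ← hn₁, h1]
  refine ⟨B, hBO, hAB, ⟨s, hs⟩, hBreg, hBdim, hBreg₁, hBdim₁, hBof, locAtCentre Ā'.toSubring O₁, hR₁O₁, ?_,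
    subringDominates_locAtCentre hĀ'O₁, hdimR₁, hreg', c, hc, hforms⟩
  -- domination `locAtCentre B O₁ ≤ R₁`
  refine ⟨?_, fun x hx hxinv => (subringDominates_locAtCentre hBO₁).2 x hx (hR₁O₁ hxinv)⟩
  rw [← hloc]; exact locAtCentre_mono O₁ hĀĀ's

end Summit.ResolutionOfSingularities.ResolutionOfSingularities.Theorems.RadicialJung.CleanModels.Ccurve

end
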